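import Summits.Ventures.PercRepro.C026TwoHubGood
import Summits.Ventures.PercRepro.C026TwoHubCount

/-!
# STEP 1 of THEOREM B, counted: `#Good_a` and `#Good_b` of the two-hub skeleton (p6, gen 22)

With the pattern fibres of C026TwoHubCount and the characterisations `goodA_attach_iff` /
`goodB_attach_iff` of C026TwoHubGood, mine-3's STEP 1 Good counts (MINE3-G23-card.md: `P =
#{¬B' ∧ R}`, `X = #{¬B' ∧ R^{av}}`, primes for `h'`, `R^{av}` = `c ~_red h` by a walk avoiding the
blue cluster of `h'`):

  `#Good_a = #Good_b = N₁ + P + X + P' + X'`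

(`card_goodA_attach`, `card_goodB_attach`): on `(RR,RR)` every source is `Good_a`; on `(RR,RB)`
`Good_a ⟺ R` (`D_a = {a}`), on `(RR,BR)` `Good_a ⟺ R^{av}` (`D_a = {a} ∪ Cl_blue(h')`); `(RB,RR)`,
`(BR,RR)` likewise with `h'`; the four patterns without an `RR` hub have no Good source.  For
`Good_b` the roles of the `a`- and `b`-edges are exchanged, which swaps `P ↔ X` and `P' ↔ X'`.
-/

namespace PercRepro

namespace MultiGraph

open Finset

variable {V E : Type*} {G : MultiGraph V E} {a b h h' c : V}

section GoodCount

variable [Fintype E] [DecidableEq E]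
variable (hab : a ≠ b) (hca : c ≠ a) (hcb : c ≠ b) (hha : h ≠ a) (hhb : h ≠ b) (hh'a : h' ≠ a)
  (hh'b : h' ≠ b) (hisoa : ∀ e, G.fst e ≠ a ∧ G.snd e ≠ a) (hisob : ∀ e, G.fst e ≠ b ∧ G.snd e ≠ b)

include hab hca hcb hha hhb hh'a hh'b hisoa hisob in
open Classical in
/-- **STEP 1 of THEOREM B, the `Good_a` count**: `#Good_a = N₁ + P + X + P' + X'`. -/
theorem card_goodA_attach :
    (univ.filter fun S : Config (E ⊕ Fin 5) =>
        (((G.attachTwoHub a b h h').Conn S c a ∧ (G.attachTwoHub a b h h').Conn S c b) ∧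
        (¬ (G.attachTwoHub a b h h').Conn Sᶜ c a ∧ ¬ (G.attachTwoHub a b h h').Conn Sᶜ c b ∧
          ¬ (G.attachTwoHub a b h h').Conn Sᶜ a b)) ∧
        (G.attachTwoHub a b h h').WalkAvoiding S ((G.attachTwoHub a b h h').cluster Sᶜ a) c b).card =
      (univ.filter fun O : Config E => G.Conn O c h ∨ G.Conn O c h').card +
      (univ.filter fun O : Config E => ¬ G.Conn Oᶜ c h' ∧ G.Conn O c h).card +
      (univ.filter fun O : Config E =>
        ¬ G.Conn Oᶜ c h' ∧ G.WalkAvoiding O (G.cluster Oᶜ h') c h).card +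
      (univ.filter fun O : Config E => ¬ G.Conn Oᶜ c h ∧ G.Conn O c h').card +
      (univ.filter fun O : Config E =>
        ¬ G.Conn Oᶜ c h ∧ G.WalkAvoiding O (G.cluster Oᶜ h) c h').card := by
  have hiff := DA_attach_iff (G := G) hab hca hcb hha hhb hh'a hh'b hisoa hisob
  have hgood := fun S : Config (E ⊕ Fin 5) =>
    goodA_attach_iff (G := G) (S := S) hab hca hcb hha hhb hh'a hh'b hisoa hisob
  set s : Finset (Config (E ⊕ Fin 5)) := univ.filter fun S : Config (E ⊕ Fin 5) =>
    (((G.attachTwoHub a b h h').Conn S c a ∧ (G.attachTwoHub a b h h').Conn S c b) ∧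
      (¬ (G.attachTwoHub a b h h').Conn Sᶜ c a ∧ ¬ (G.attachTwoHub a b h h').Conn Sᶜ c b ∧
        ¬ (G.attachTwoHub a b h h').Conn Sᶜ a b)) ∧
      (G.attachTwoHub a b h h').WalkAvoiding S ((G.attachTwoHub a b h h').cluster Sᶜ a) c b
    with hs_def
  have hmem : ∀ S, S ∈ s ↔ (S (Sum.inr 4) = true ∧ (S (Sum.inr 0) = true ∨ S (Sum.inr 1) = true) ∧
      (S (Sum.inr 2) = true ∨ S (Sum.inr 3) = true) ∧
      (G.Conn (S ∘ Sum.inl) c h ∨ G.Conn (S ∘ Sum.inl) c h') ∧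
      (S (Sum.inr 0) = false → ¬ G.Conn (S ∘ Sum.inl)ᶜ c h) ∧
      (S (Sum.inr 1) = false → ¬ G.Conn (S ∘ Sum.inl)ᶜ c h) ∧
      (S (Sum.inr 2) = false → ¬ G.Conn (S ∘ Sum.inl)ᶜ c h') ∧
      (S (Sum.inr 3) = false → ¬ G.Conn (S ∘ Sum.inl)ᶜ c h') ∧
      (S (Sum.inr 0) = false → S (Sum.inr 3) = false → ¬ G.Conn (S ∘ Sum.inl)ᶜ h h') ∧
      (S (Sum.inr 1) = false → S (Sum.inr 2) = false → ¬ G.Conn (S ∘ Sum.inl)ᶜ h h')) ∧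
      ((S (Sum.inr 0) = true ∧ S (Sum.inr 1) = true ∧
          G.WalkAvoiding (S ∘ Sum.inl) ({a} ∪
            {v | S (Sum.inr 0) = false ∧ v ∈ G.cluster (S ∘ Sum.inl)ᶜ h} ∪
            {v | S (Sum.inr 2) = false ∧ v ∈ G.cluster (S ∘ Sum.inl)ᶜ h'}) c h) ∨
        (S (Sum.inr 2) = true ∧ S (Sum.inr 3) = true ∧
          G.WalkAvoiding (S ∘ Sum.inl) ({a} ∪
            {v | S (Sum.inr 0) = false ∧ v ∈ G.cluster (S ∘ Sum.inl)ᶜ h} ∪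
            {v | S (Sum.inr 2) = false ∧ v ∈ G.cluster (S ∘ Sum.inl)ᶜ h'}) c h')) := by
    intro S
    rw [hs_def, mem_filter]
    simp only [mem_univ, true_and]
    constructor
    · rintro ⟨hS, hg⟩
      exact ⟨(hiff S).1 hS, (hgood S hS).1 hg⟩
    · rintro ⟨hS, hg⟩
      have hS' := (hiff S).2 hS
      exact ⟨hS', (hgood S hS').2 hg⟩
  have h4 : ∀ S ∈ s, S (Sum.inr 4) = true := fun S hS => ((hmem S).1 hS).1.1
  have h01 : ∀ S ∈ s, S (Sum.inr 0) = true ∨ S (Sum.inr 1) = true :=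
    fun S hS => ((hmem S).1 hS).1.2.1
  have h23 : ∀ S ∈ s, S (Sum.inr 2) = true ∨ S (Sum.inr 3) = true :=
    fun S hS => ((hmem S).1 hS).1.2.2.1
  have hisoA : ∀ w ∈ ({a} : Set V), ∀ e, G.fst e ≠ w ∧ G.snd e ≠ w := by
    intro w hw
    rw [Set.mem_singleton_iff] at hw
    rw [hw]
    exact hisoa
  have hcA : c ∉ ({a} : Set V) := by simpa using hca
  have hW1 : ∀ (O : Config E) (v : V), G.WalkAvoiding O {a} c v ↔ G.Conn O c v :=
    fun O v => walkAvoiding_iff_conn_of_isolated hisoA hcA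
  have hW2 : ∀ (O : Config E) (K : Set V) (v : V),
      G.WalkAvoiding O ({a} ∪ K) c v ↔ G.WalkAvoiding O K c v :=
    fun O K v => walkAvoiding_union_iff_of_isolated hisoA hcA
  rw [card_eq_sum_patterns s, sum_bool_four]
  rw [card_fibre_bb_h s h01, card_fibre_bb_h s h01, card_fibre_bb_h s h01, card_fibre_bb_h s h01,
    card_fibre_bb_h' s h23, card_fibre_bb_h' s h23, card_fibre_bb_h' s h23]
  rw [card_fibre true true true true true s h4, card_fibre true true true false true s h4,
    card_fibre true true false true true s h4, card_fibre true false true true true s h4,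
    card_fibre true false true false true s h4, card_fibre true false false true true s h4,
    card_fibre false true true true true s h4, card_fibre false true true false true s h4,
    card_fibre false true false true true s h4]
  simp only [hmem, Sum.elim_inr, Sum.elim_comp_inl, Matrix.cons_val_zero, Matrix.cons_val_one,
    Matrix.head_cons, Matrix.cons_val_two, Matrix.tail_cons, Matrix.cons_val_three,
    Matrix.cons_val_four, Bool.true_eq_false, Bool.false_eq_true, or_false, or_true, true_and,
    and_true, IsEmpty.forall_iff, forall_const, and_self, false_and, and_false, or_self,
    false_or, Finset.filter_false, Finset.card_empty, Set.setOf_false, Set.union_empty,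
    Set.setOf_mem_eq, hW1, hW2]
  have e1 : (univ.filter fun x : Config E =>
      ((G.Conn x c h ∨ G.Conn x c h') ∧ ¬ G.Conn xᶜ c h') ∧ G.Conn x c h) =
      univ.filter fun O : Config E => ¬ G.Conn Oᶜ c h' ∧ G.Conn O c h :=
    Finset.filter_congr (fun O _ => by tauto)
  have e2 : (univ.filter fun x : Config E =>
      ((G.Conn x c h ∨ G.Conn x c h') ∧ ¬ G.Conn xᶜ c h') ∧ G.WalkAvoiding x (G.cluster xᶜ h') c h) =
      univ.filter fun O : Config E => ¬ G.Conn Oᶜ c h' ∧ G.WalkAvoiding O (G.cluster Oᶜ h') c h :=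
    Finset.filter_congr (fun O _ => ⟨fun hh => ⟨hh.1.2, hh.2⟩, fun hh => ⟨⟨Or.inl hh.2.conn, hh.1⟩, hh.2⟩⟩)
  have e3 : (univ.filter fun x : Config E =>
      ((G.Conn x c h ∨ G.Conn x c h') ∧ ¬ G.Conn xᶜ c h) ∧ G.Conn x c h') =
      univ.filter fun O : Config E => ¬ G.Conn Oᶜ c h ∧ G.Conn O c h' :=
    Finset.filter_congr (fun O _ => by tauto)
  have e4 : (univ.filter fun x : Config E =>
      ((G.Conn x c h ∨ G.Conn x c h') ∧ ¬ G.Conn xᶜ c h) ∧ G.WalkAvoiding x (G.cluster xᶜ h) c h') =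
      univ.filter fun O : Config E => ¬ G.Conn Oᶜ c h ∧ G.WalkAvoiding O (G.cluster Oᶜ h) c h' :=
    Finset.filter_congr (fun O _ => ⟨fun hh => ⟨hh.1.2, hh.2⟩, fun hh => ⟨⟨Or.inr hh.2.conn, hh.1⟩, hh.2⟩⟩)
  rw [e1, e2, e3, e4]
  ring

include hab hca hcb hha hhb hh'a hh'b hisoa hisob in
open Classical in
/-- **STEP 1 of THEOREM B, the `Good_b` count**: `#Good_b = N₁ + P + X + P' + X'`. -/
theorem card_goodB_attach :
    (univ.filter fun S : Config (E ⊕ Fin 5) =>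
        (((G.attachTwoHub a b h h').Conn S c a ∧ (G.attachTwoHub a b h h').Conn S c b) ∧
        (¬ (G.attachTwoHub a b h h').Conn Sᶜ c a ∧ ¬ (G.attachTwoHub a b h h').Conn Sᶜ c b ∧
          ¬ (G.attachTwoHub a b h h').Conn Sᶜ a b)) ∧
        (G.attachTwoHub a b h h').WalkAvoiding S ((G.attachTwoHub a b h h').cluster Sᶜ b) c a).card =
      (univ.filter fun O : Config E => G.Conn O c h ∨ G.Conn O c h').card +
      (univ.filter fun O : Config E => ¬ G.Conn Oᶜ c h' ∧ G.Conn O c h).card +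
      (univ.filter fun O : Config E =>
        ¬ G.Conn Oᶜ c h' ∧ G.WalkAvoiding O (G.cluster Oᶜ h') c h).card +
      (univ.filter fun O : Config E => ¬ G.Conn Oᶜ c h ∧ G.Conn O c h').card +
      (univ.filter fun O : Config E =>
        ¬ G.Conn Oᶜ c h ∧ G.WalkAvoiding O (G.cluster Oᶜ h) c h').card := by
  have hiff := DA_attach_iff (G := G) hab hca hcb hha hhb hh'a hh'b hisoa hisob
  have hgood := fun S : Config (E ⊕ Fin 5) =>
    goodB_attach_iff (G := G) (S := S) hab hca hcb hha hhb hh'a hh'b hisoa hisob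
  set s : Finset (Config (E ⊕ Fin 5)) := univ.filter fun S : Config (E ⊕ Fin 5) =>
    (((G.attachTwoHub a b h h').Conn S c a ∧ (G.attachTwoHub a b h h').Conn S c b) ∧
      (¬ (G.attachTwoHub a b h h').Conn Sᶜ c a ∧ ¬ (G.attachTwoHub a b h h').Conn Sᶜ c b ∧
        ¬ (G.attachTwoHub a b h h').Conn Sᶜ a b)) ∧
      (G.attachTwoHub a b h h').WalkAvoiding S ((G.attachTwoHub a b h h').cluster Sᶜ b) c a
    with hs_def
  have hmem : ∀ S, S ∈ s ↔ (S (Sum.inr 4) = true ∧ (S (Sum.inr 0) = true ∨ S (Sum.inr 1) = true) ∧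
      (S (Sum.inr 2) = true ∨ S (Sum.inr 3) = true) ∧
      (G.Conn (S ∘ Sum.inl) c h ∨ G.Conn (S ∘ Sum.inl) c h') ∧
      (S (Sum.inr 0) = false → ¬ G.Conn (S ∘ Sum.inl)ᶜ c h) ∧
      (S (Sum.inr 1) = false → ¬ G.Conn (S ∘ Sum.inl)ᶜ c h) ∧
      (S (Sum.inr 2) = false → ¬ G.Conn (S ∘ Sum.inl)ᶜ c h') ∧
      (S (Sum.inr 3) = false → ¬ G.Conn (S ∘ Sum.inl)ᶜ c h') ∧
      (S (Sum.inr 0) = false → S (Sum.inr 3) = false → ¬ G.Conn (S ∘ Sum.inl)ᶜ h h') ∧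
      (S (Sum.inr 1) = false → S (Sum.inr 2) = false → ¬ G.Conn (S ∘ Sum.inl)ᶜ h h')) ∧
      ((S (Sum.inr 0) = true ∧ S (Sum.inr 1) = true ∧
          G.WalkAvoiding (S ∘ Sum.inl) ({b} ∪
            {v | S (Sum.inr 1) = false ∧ v ∈ G.cluster (S ∘ Sum.inl)ᶜ h} ∪
            {v | S (Sum.inr 3) = false ∧ v ∈ G.cluster (S ∘ Sum.inl)ᶜ h'}) c h) ∨
        (S (Sum.inr 2) = true ∧ S (Sum.inr 3) = true ∧
          G.WalkAvoiding (S ∘ Sum.inl) ({b} ∪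
            {v | S (Sum.inr 1) = false ∧ v ∈ G.cluster (S ∘ Sum.inl)ᶜ h} ∪
            {v | S (Sum.inr 3) = false ∧ v ∈ G.cluster (S ∘ Sum.inl)ᶜ h'}) c h')) := by
    intro S
    rw [hs_def, mem_filter]
    simp only [mem_univ, true_and]
    constructor
    · rintro ⟨hS, hg⟩
      exact ⟨(hiff S).1 hS, (hgood S hS).1 hg⟩
    · rintro ⟨hS, hg⟩
      have hS' := (hiff S).2 hS
      exact ⟨hS', (hgood S hS').2 hg⟩
  have h4 : ∀ S ∈ s, S (Sum.inr 4) = true := fun S hS => ((hmem S).1 hS).1.1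
  have h01 : ∀ S ∈ s, S (Sum.inr 0) = true ∨ S (Sum.inr 1) = true :=
    fun S hS => ((hmem S).1 hS).1.2.1
  have h23 : ∀ S ∈ s, S (Sum.inr 2) = true ∨ S (Sum.inr 3) = true :=
    fun S hS => ((hmem S).1 hS).1.2.2.1
  have hisoB : ∀ w ∈ ({b} : Set V), ∀ e, G.fst e ≠ w ∧ G.snd e ≠ w := by
    intro w hw
    rw [Set.mem_singleton_iff] at hw
    rw [hw]
    exact hisob
  have hcB : c ∉ ({b} : Set V) := by simpa using hcb
  have hW1 : ∀ (O : Config E) (v : V), G.WalkAvoiding O {b} c v ↔ G.Conn O c v :=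
    fun O v => walkAvoiding_iff_conn_of_isolated hisoB hcB
  have hW2 : ∀ (O : Config E) (K : Set V) (v : V),
      G.WalkAvoiding O ({b} ∪ K) c v ↔ G.WalkAvoiding O K c v :=
    fun O K v => walkAvoiding_union_iff_of_isolated hisoB hcB
  rw [card_eq_sum_patterns s, sum_bool_four]
  rw [card_fibre_bb_h s h01, card_fibre_bb_h s h01, card_fibre_bb_h s h01, card_fibre_bb_h s h01,
    card_fibre_bb_h' s h23, card_fibre_bb_h' s h23, card_fibre_bb_h' s h23]
  rw [card_fibre true true true true true s h4, card_fibre true true true false true s h4,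
    card_fibre true true false true true s h4, card_fibre true false true true true s h4,
    card_fibre true false true false true s h4, card_fibre true false false true true s h4,
    card_fibre false true true true true s h4, card_fibre false true true false true s h4,
    card_fibre false true false true true s h4]
  simp only [hmem, Sum.elim_inr, Sum.elim_comp_inl, Matrix.cons_val_zero, Matrix.cons_val_one,
    Matrix.head_cons, Matrix.cons_val_two, Matrix.tail_cons, Matrix.cons_val_three,
    Matrix.cons_val_four, Bool.true_eq_false, Bool.false_eq_true, or_false, or_true, true_and,
    and_true, IsEmpty.forall_iff, forall_const, and_self, false_and, and_false, or_self,
    false_or, Finset.filter_false, Finset.card_empty, Set.setOf_false, Set.union_empty,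
    Set.setOf_mem_eq, hW1, hW2]
  have e1 : (univ.filter fun x : Config E =>
      ((G.Conn x c h ∨ G.Conn x c h') ∧ ¬ G.Conn xᶜ c h') ∧ G.Conn x c h) =
      univ.filter fun O : Config E => ¬ G.Conn Oᶜ c h' ∧ G.Conn O c h :=
    Finset.filter_congr (fun O _ => by tauto)
  have e2 : (univ.filter fun x : Config E =>
      ((G.Conn x c h ∨ G.Conn x c h') ∧ ¬ G.Conn xᶜ c h') ∧ G.WalkAvoiding x (G.cluster xᶜ h') c h) =
      univ.filter fun O : Config E => ¬ G.Conn Oᶜ c h' ∧ G.WalkAvoiding O (G.cluster Oᶜ h') c h :=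
    Finset.filter_congr (fun O _ => ⟨fun hh => ⟨hh.1.2, hh.2⟩, fun hh => ⟨⟨Or.inl hh.2.conn, hh.1⟩, hh.2⟩⟩)
  have e3 : (univ.filter fun x : Config E =>
      ((G.Conn x c h ∨ G.Conn x c h') ∧ ¬ G.Conn xᶜ c h) ∧ G.Conn x c h') =
      univ.filter fun O : Config E => ¬ G.Conn Oᶜ c h ∧ G.Conn O c h' :=
    Finset.filter_congr (fun O _ => by tauto)
  have e4 : (univ.filter fun x : Config E =>
      ((G.Conn x c h ∨ G.Conn x c h') ∧ ¬ G.Conn xᶜ c h) ∧ G.WalkAvoiding x (G.cluster xᶜ h) c h') =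
      univ.filter fun O : Config E => ¬ G.Conn Oᶜ c h ∧ G.WalkAvoiding O (G.cluster Oᶜ h) c h' :=
    Finset.filter_congr (fun O _ => ⟨fun hh => ⟨hh.1.2, hh.2⟩, fun hh => ⟨⟨Or.inr hh.2.conn, hh.1⟩, hh.2⟩⟩)
  rw [e1, e2, e3, e4]
  ring

end GoodCount

end MultiGraph

end PercRepro
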